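import Mathlib
import Literature.NumberTheory.Irrationality.Fischler2002.JnChiProofs
import Literature.NumberTheory.Irrationality.Fischler2002.EulerKernelBoundsProofs
import HarnessLib

/-!
# Fischler's finiteness criterion for `𝒥(p)` — III: peeling the last variable (finiteness of the peeled integrals)

Topic `Literature/NumberTheory/Irrationality/Fischler2002`; proofs-only companion of `RhinViolaGroupsGeneral.lean`
(named fact `Jn_finite_iff`) and `FamilyJ.lean` (`integralJ_finite_iff`). Source: S. Fischler, « Formes linéaires en
polyzêtas et intégrales multiples », C. R. Acad. Sci. Paris Sér. I **335** (2002) 1–4 = arXiv:math/0202064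
[Fischler2002Polyzetas], §3 p. 4; proof in S. Fischler, *Groupes de Rhin-Viola et intégrales multiples*, J. Théor.
Nombres Bordeaux **15** (2003) 479–534 [Fischler2003RhinViola], §4.1 Proposition 13 (cell `pub-zeta5`, seat ct-1 g32,
2026-08-27).

HONEST FRAMING (cells pub-zeta5 / zeta5-irr): systematic search; no irrationality claim unless certified. Real analysis
only (Tonelli and one-variable estimates for integrals of non-negative functions); nothing about `ζ(5)`.

## The peeling
Since `δ_{m+1}(x′, t) = 1 − t·δ_m(x′)` and `1 − δ_m(x′) = x_m δ_{m−1}(x′)`, integrating out the last variable of an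
`(m+1)`-fold integrand of the shape
`Φ = ∏_{k ≤ m+1} x_k^{α_k}(1−x_k)^{β_k}δ_k^{−γ_k} · x_{m+1}^{−r_{m+2}} δ_m^{−r_{m+2}} δ_{m+1}^{−r_{m+3}}`
(real exponents `α, β, γ, r : ℕ → ℝ`) by the Euler-kernel bound `∫₀¹ t^a(1−t)^b(1−tδ_m)^{−g}dt ≤ C(1−δ_m)^{−r_{m+1}}`
returns an `m`-fold integrand of the SAME shape with the SAME exponent functions. Hence one statement,
`lintegral_phi_lt_top`, quantified over `α, β, γ, r` with pointwise inequalities, is proved by induction on the number of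
variables (Tonelli step: the tree's `JnChi.lintegral_openCube_succ`). With `α = a`, `β = b`, `γ_k = c̃_k` (`γ₁ = 0`) and
`r_k = ρ_k⁺ + (n+3−k)ε` this gives the «if» half of the criterion (`JnFinitenessCriterionProofs.lean`); this file also
identifies `integrandJ` with the real-exponent product on the open cube (`integrandJ_eq_rpow_prod`). Theorems only, no
definition, no new named fact.
-/

noncomputable section

namespace Literature.NumberTheory.Irrationality.Fischler2002

open MeasureTheory Set Finset JnChi
open scoped ENNReal

namespace JnFinite

/-! ### The open cube -/

/-- Membership in the open cube `(0,1)^m`, coordinatewise. [cite: Fischler2002Polyzetas, §3 p. 4 (intégrales sur [0,1]^n)] -/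
theorem mem_openCube_iff {m : ℕ} {x : Fin m → ℝ} :
    x ∈ (Set.pi Set.univ fun _ : Fin m => Ioo (0 : ℝ) 1) ↔ ∀ i, 0 < x i ∧ x i < 1 := by
  simp [Set.mem_pi, Set.mem_Ioo]

/-- The open cube `(0,1)^m` has volume `1`. [cite: Fischler2002Polyzetas, §3 p. 4 (intégrales sur [0,1]^n)] -/
theorem volume_openCube (m : ℕ) : volume (Set.pi Set.univ fun _ : Fin m => Ioo (0 : ℝ) 1) = 1 := by
  rw [volume_pi, Measure.pi_pi]
  simp [Real.volume_Ioo]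

/-- On the open cube, `0 < x_k < 1` for `1 ≤ k ≤ m`. [cite: Fischler2002Polyzetas, §3 p. 4 (intégrales sur [0,1]^n)] -/
theorem coord_mem {m : ℕ} {x : Fin m → ℝ} (hx : ∀ i, 0 < x i ∧ x i < 1) {k : ℕ} (hk1 : 1 ≤ k) (hkm : k ≤ m) :
    0 < coord x k ∧ coord x k < 1 := by
  unfold coord
  rw [dif_pos ⟨hk1, hkm⟩]
  exact hx _

/-- Coordinates are non-negative everywhere (junk value `0` outside the range). [cite: Fischler2002Polyzetas, §2 p. 2 (notation x_k)] -/
theorem coord_nonneg_of {m : ℕ} {x : Fin m → ℝ} (hx : ∀ i, 0 < x i ∧ x i < 1) (k : ℕ) : 0 ≤ coord x k := by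
  unfold coord
  split_ifs with h
  · exact (hx _).1.le
  · exact le_rfl

/-- `1 − δ_{m+1}(x) = x_{m+1} δ_m(x)`. [cite: Fischler2002Polyzetas, §1 p. 2 (definition of δ_k)] -/
theorem one_sub_deltaV_succ {n : ℕ} (x : Fin n → ℝ) (m : ℕ) :
    1 - deltaV x (m + 1) = coord x (m + 1) * deltaV x m := by
  rw [deltaV]; ring

/-- `∏_{k=1}^{n} f(k) = f(1) · ∏_{k=2}^{n} f(k)` for `n ≥ 1`. [cite: Fischler2002Polyzetas, §3 p. 4 (produits sur k)] -/
theorem prod_Icc_one_eq_mul {M : Type*} [CommMonoid M] {n : ℕ} (hn : 1 ≤ n) (f : ℕ → M) :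
    ∏ k ∈ Icc 1 n, f k = f 1 * ∏ k ∈ Icc 2 n, f k := by
  rw [← Finset.Ico_add_one_right_eq_Icc, Finset.prod_eq_prod_Ico_succ_bot (by omega),
    Finset.Ico_add_one_right_eq_Icc]

/-! ### The real-exponent integrand `Φ`: measurability, positivity, fibre form -/

/-- Measurability of the real-exponent integrand
`Φ_m = ∏_{k≤m} x_k^{α_k}(1−x_k)^{β_k}δ_k^{−γ_k} · x_m^{−r_{m+1}} δ_{m−1}^{−r_{m+1}} δ_m^{−r_{m+2}}`.
[cite: Fischler2003RhinViola, §4.1 Proposition 13 (the peeled integrand)] -/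
theorem measurable_phi (α β γ r : ℕ → ℝ) (m : ℕ) :
    Measurable fun x : Fin m → ℝ =>
      (∏ k ∈ Icc 1 m, coord x k ^ α k * (1 - coord x k) ^ β k * deltaV x k ^ (-γ k)) *
        (coord x m ^ (-r (m + 1)) * deltaV x (m - 1) ^ (-r (m + 1)) * deltaV x m ^ (-r (m + 2))) := by
  refine (Finset.measurable_prod _ fun k _ => ?_).mul ?_
  · exact (((measurable_coord k).pow_const _).mul ((measurable_const.sub (measurable_coord k)).pow_const _)).mul
      ((measurable_deltaV k).pow_const _)
  · exact (((measurable_coord m).pow_const _).mul ((measurable_deltaV (m - 1)).pow_const _)).mul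
      ((measurable_deltaV m).pow_const _)

/-- The product part of `Φ` is positive on the open cube. [cite: Fischler2003RhinViola, §4.1 Proposition 13 (the peeled integrand)] -/
theorem phiProd_pos (α β γ : ℕ → ℝ) {m : ℕ} {x : Fin m → ℝ} (hx : ∀ i, 0 < x i ∧ x i < 1) :
    0 < ∏ k ∈ Icc 1 m, coord x k ^ α k * (1 - coord x k) ^ β k * deltaV x k ^ (-γ k) := by
  refine Finset.prod_pos fun k hk => ?_
  have hk' := Finset.mem_Icc.1 hk
  obtain ⟨h0, h1⟩ := coord_mem hx hk'.1 hk'.2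
  have hd := (deltaV_mem hx k hk'.2).1
  exact mul_pos (mul_pos (Real.rpow_pos_of_pos h0 _) (Real.rpow_pos_of_pos (by linarith) _)) (Real.rpow_pos_of_pos hd _)

/-- `Φ_m` is positive on the open cube (`m ≥ 1`). [cite: Fischler2003RhinViola, §4.1 Proposition 13 (the peeled integrand)] -/
theorem phi_pos (α β γ r : ℕ → ℝ) {m : ℕ} (hm : 1 ≤ m) {x : Fin m → ℝ} (hx : ∀ i, 0 < x i ∧ x i < 1) :
    0 < (∏ k ∈ Icc 1 m, coord x k ^ α k * (1 - coord x k) ^ β k * deltaV x k ^ (-γ k)) *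
        (coord x m ^ (-r (m + 1)) * deltaV x (m - 1) ^ (-r (m + 1)) * deltaV x m ^ (-r (m + 2))) := by
  refine mul_pos (phiProd_pos α β γ hx) ?_
  obtain ⟨h0, -⟩ := coord_mem hx hm le_rfl
  have hd := (deltaV_mem hx m le_rfl).1
  have hd' := (deltaV_mem hx (m - 1) (by omega)).1
  exact mul_pos (mul_pos (Real.rpow_pos_of_pos h0 _) (Real.rpow_pos_of_pos hd' _)) (Real.rpow_pos_of_pos hd _)

/-- **Fibre form of `Φ`**: for `x′ ∈ (0,1)^m` (`m ≥ 1`) and `t ∈ (0,1)`,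
`Φ_{m+1}(x′, t) = [∏_{k≤m}(…)(x′) · δ_m(x′)^{−r_{m+2}}] · t^{α_{m+1}−r_{m+2}}(1−t)^{β_{m+1}}(1 − tδ_m(x′))^{−(γ_{m+1}+r_{m+3})}`.
[cite: Fischler2003RhinViola, §4.1 Proposition 13 (intégration en x_n)] -/
theorem phi_snoc (α β γ r : ℕ → ℝ) {m : ℕ} (hm : 1 ≤ m) {x' : Fin m → ℝ} (hx : ∀ i, 0 < x' i ∧ x' i < 1)
    {t : ℝ} (ht : t ∈ Ioo (0 : ℝ) 1) :
    (∏ k ∈ Icc 1 (m + 1), coord (Fin.snoc x' t : Fin (m + 1) → ℝ) k ^ α k *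
          (1 - coord (Fin.snoc x' t : Fin (m + 1) → ℝ) k) ^ β k *
          deltaV (Fin.snoc x' t : Fin (m + 1) → ℝ) k ^ (-γ k)) *
        (coord (Fin.snoc x' t : Fin (m + 1) → ℝ) (m + 1) ^ (-r (m + 1 + 1)) *
          deltaV (Fin.snoc x' t : Fin (m + 1) → ℝ) (m + 1 - 1) ^ (-r (m + 1 + 1)) *
          deltaV (Fin.snoc x' t : Fin (m + 1) → ℝ) (m + 1) ^ (-r (m + 1 + 2))) =
      ((∏ k ∈ Icc 1 m, coord x' k ^ α k * (1 - coord x' k) ^ β k * deltaV x' k ^ (-γ k)) *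
          deltaV x' m ^ (-r (m + 2))) *
        (t ^ (α (m + 1) - r (m + 2)) * (1 - t) ^ β (m + 1) *
          (1 - t * deltaV x' m) ^ (-(γ (m + 1) + r (m + 3)))) := by
  have hδ := (deltaV_mem hx m le_rfl).1
  have hδ1 := (deltaV_mem hx m le_rfl).2.2 hm
  obtain ⟨-, -, hden⟩ := one_sub_mul_mem ht.1.le ht.2.le hδ.le hδ1
  rw [Finset.prod_Icc_succ_top (by omega : 1 ≤ m + 1), coord_snoc_last, deltaV_snoc_last,
    show m + 1 - 1 = m from rfl, deltaV_snoc_of_le x' t le_rfl]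
  have hP : ∏ k ∈ Icc 1 m, coord (Fin.snoc x' t : Fin (m + 1) → ℝ) k ^ α k *
        (1 - coord (Fin.snoc x' t : Fin (m + 1) → ℝ) k) ^ β k *
        deltaV (Fin.snoc x' t : Fin (m + 1) → ℝ) k ^ (-γ k) =
      ∏ k ∈ Icc 1 m, coord x' k ^ α k * (1 - coord x' k) ^ β k * deltaV x' k ^ (-γ k) :=
    Finset.prod_congr rfl fun k hk => by
      rw [coord_snoc_of_le x' t (Finset.mem_Icc.1 hk).2, deltaV_snoc_of_le x' t (Finset.mem_Icc.1 hk).2]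
  rw [hP, show m + 1 + 1 = m + 2 from rfl, show m + 1 + 2 = m + 3 from rfl,
    show α (m + 1) - r (m + 2) = α (m + 1) + (-r (m + 2)) by ring, Real.rpow_add ht.1,
    show -(γ (m + 1) + r (m + 3)) = -γ (m + 1) + (-r (m + 3)) by ring, Real.rpow_add hden]
  ring

/-- **Recombination**: for `x′ ∈ (0,1)^m` (`m ≥ 1`),
`[∏_{k≤m}(…) · δ_m^{−r_{m+2}}] · (1 − δ_m)^{−r_{m+1}} = Φ_m(x′)`, because `1 − δ_m = x_m δ_{m−1}`.
[cite: Fischler2003RhinViola, §4.1 Proposition 13 (intégration en x_n)] -/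
theorem phi_factor (α β γ r : ℕ → ℝ) {m : ℕ} (hm : 1 ≤ m) {x : Fin m → ℝ} (hx : ∀ i, 0 < x i ∧ x i < 1) :
    ((∏ k ∈ Icc 1 m, coord x k ^ α k * (1 - coord x k) ^ β k * deltaV x k ^ (-γ k)) *
          deltaV x m ^ (-r (m + 2))) * (1 - deltaV x m) ^ (-r (m + 1)) =
      (∏ k ∈ Icc 1 m, coord x k ^ α k * (1 - coord x k) ^ β k * deltaV x k ^ (-γ k)) *
        (coord x m ^ (-r (m + 1)) * deltaV x (m - 1) ^ (-r (m + 1)) * deltaV x m ^ (-r (m + 2))) := by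
  obtain ⟨m', rfl⟩ : ∃ m', m = m' + 1 := ⟨m - 1, by omega⟩
  rw [one_sub_deltaV_succ, show m' + 1 - 1 = m' from rfl,
    Real.mul_rpow (coord_nonneg_of hx _) (deltaV_mem hx m' (by omega)).1.le]
  ring

/-- `δ₀ = 1`. [cite: Fischler2002Polyzetas, §1 p. 2 (definition of δ_k)] -/
theorem deltaV_zero {n : ℕ} (x : Fin n → ℝ) : deltaV x 0 = 1 := by
  rw [deltaV]

/-- **`Φ₁` is a Beta kernel**: for `t ∈ (0,1)` (and the empty tuple `x′`),
`Φ₁(x′, t) = t^{α₁−r₂}(1−t)^{β₁−γ₁−r₃}`. [cite: Fischler2003RhinViola, §4.1 Proposition 13 (the case of one variable)] -/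
theorem phi_one (α β γ r : ℕ → ℝ) (x' : Fin 0 → ℝ) {t : ℝ} (ht : t ∈ Ioo (0 : ℝ) 1) :
    (∏ k ∈ Icc 1 (0 + 1), coord (Fin.snoc x' t : Fin (0 + 1) → ℝ) k ^ α k *
          (1 - coord (Fin.snoc x' t : Fin (0 + 1) → ℝ) k) ^ β k *
          deltaV (Fin.snoc x' t : Fin (0 + 1) → ℝ) k ^ (-γ k)) *
        (coord (Fin.snoc x' t : Fin (0 + 1) → ℝ) (0 + 1) ^ (-r (0 + 1 + 1)) *
          deltaV (Fin.snoc x' t : Fin (0 + 1) → ℝ) (0 + 1 - 1) ^ (-r (0 + 1 + 1)) *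
          deltaV (Fin.snoc x' t : Fin (0 + 1) → ℝ) (0 + 1) ^ (-r (0 + 1 + 2))) =
      t ^ (α 1 - r 2) * (1 - t) ^ (β 1 - γ 1 - r 3) := by
  have h0 := ht.1
  have h1' : 0 < 1 - t := by linarith [ht.2]
  rw [Finset.prod_Icc_succ_top (by omega : 1 ≤ 0 + 1), Finset.Icc_eq_empty (by omega), Finset.prod_empty,
    one_mul, show 0 + 1 - 1 = 0 from rfl, deltaV_snoc_last, coord_snoc_last, deltaV_zero, deltaV_zero, mul_one,
    Real.one_rpow, mul_one, show 0 + 1 + 1 = 2 from rfl, show 0 + 1 + 2 = 3 from rfl, show (0 + 1 : ℕ) = 1 from rfl,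
    show α 1 - r 2 = α 1 + (-r 2) by ring, Real.rpow_add h0,
    show β 1 - γ 1 - r 3 = β 1 + (-γ 1) + (-r 3) by ring, Real.rpow_add h1', Real.rpow_add h1']
  ring

/-! ### The induction on the number of variables -/

/-- **Finiteness of the peeled integrals.** For real exponent functions `α, β, γ, r` with `r ≥ 0`,
`α_k − r_{k+1} > −1` (`1 ≤ k ≤ n`), `β_k > −1` and `γ_k + r_{k+2} − β_k − 1 < r_k` (`2 ≤ k ≤ n`), and
`β₁ − γ₁ − r₃ > −1`, every `Φ_m` (`1 ≤ m ≤ n`) has finite integral over `(0,1)^m` — induction on `m`, integrating the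
last variable by the Euler-kernel upper bound. [cite: Fischler2003RhinViola, §4.1 Proposition 13 (récurrence sur n)] -/
theorem lintegral_phi_lt_top (n : ℕ) (α β γ r : ℕ → ℝ) (hr : ∀ k, 0 ≤ r k)
    (hα : ∀ k, 1 ≤ k → k ≤ n → -1 < α k - r (k + 1)) (hβ : ∀ k, 2 ≤ k → k ≤ n → -1 < β k)
    (hγ : ∀ k, 2 ≤ k → k ≤ n → γ k + r (k + 2) - β k - 1 < r k) (h1 : -1 < β 1 - γ 1 - r 3) :
    ∀ m, 1 ≤ m → m ≤ n →
      ∫⁻ x in (Set.pi Set.univ fun _ : Fin m => Ioo (0 : ℝ) 1),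
        ENNReal.ofReal ((∏ k ∈ Icc 1 m, coord x k ^ α k * (1 - coord x k) ^ β k * deltaV x k ^ (-γ k)) *
          (coord x m ^ (-r (m + 1)) * deltaV x (m - 1) ^ (-r (m + 1)) * deltaV x m ^ (-r (m + 2)))) < ∞ := by
  intro m hm hmn
  induction m with
  | zero => omega
  | succ m ih =>
    rcases Nat.eq_zero_or_pos m with rfl | hmpos
    · -- one variable: a Beta integral
      rw [lintegral_openCube_succ _ (measurable_phi α β γ r (0 + 1)).ennreal_ofReal]
      have hinner : ∀ x' : Fin 0 → ℝ,
          ∫⁻ t in Ioo (0 : ℝ) 1, ENNReal.ofReal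
            ((∏ k ∈ Icc 1 (0 + 1), coord (Fin.snoc x' t : Fin (0 + 1) → ℝ) k ^ α k *
                (1 - coord (Fin.snoc x' t : Fin (0 + 1) → ℝ) k) ^ β k *
                deltaV (Fin.snoc x' t : Fin (0 + 1) → ℝ) k ^ (-γ k)) *
              (coord (Fin.snoc x' t : Fin (0 + 1) → ℝ) (0 + 1) ^ (-r (0 + 1 + 1)) *
                deltaV (Fin.snoc x' t : Fin (0 + 1) → ℝ) (0 + 1 - 1) ^ (-r (0 + 1 + 1)) *
                deltaV (Fin.snoc x' t : Fin (0 + 1) → ℝ) (0 + 1) ^ (-r (0 + 1 + 2)))) =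
            ∫⁻ t in Ioo (0 : ℝ) 1, ENNReal.ofReal (t ^ (α 1 - r 2) * (1 - t) ^ (β 1 - γ 1 - r 3)) := by
        intro x'
        refine setLIntegral_congr_fun measurableSet_Ioo fun t ht => ?_
        rw [phi_one α β γ r x' ht]
      simp only [hinner]
      rw [setLIntegral_const, volume_openCube, mul_one]
      exact lintegral_beta_lt_top (by simpa using hα 1 le_rfl (by omega)) h1
    · -- peel the last variable
      have ih' := ih hmpos (by omega)
      obtain ⟨C, hC, hCb⟩ := lintegral_eulerKernel_le (α := α (m + 1) - r (m + 2)) (β := β (m + 1))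
        (γ := γ (m + 1) + r (m + 3)) (r := r (m + 1)) (hα (m + 1) (by omega) hmn)
        (hβ (m + 1) (by omega) hmn) (hr (m + 1)) (by have := hγ (m + 1) (by omega) hmn; linarith)
      rw [lintegral_openCube_succ _ (measurable_phi α β γ r (m + 1)).ennreal_ofReal]
      calc ∫⁻ x' in (Set.pi Set.univ fun _ : Fin m => Ioo (0 : ℝ) 1), ∫⁻ t in Ioo (0 : ℝ) 1, ENNReal.ofReal
              ((∏ k ∈ Icc 1 (m + 1), coord (Fin.snoc x' t : Fin (m + 1) → ℝ) k ^ α k *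
                  (1 - coord (Fin.snoc x' t : Fin (m + 1) → ℝ) k) ^ β k *
                  deltaV (Fin.snoc x' t : Fin (m + 1) → ℝ) k ^ (-γ k)) *
                (coord (Fin.snoc x' t : Fin (m + 1) → ℝ) (m + 1) ^ (-r (m + 1 + 1)) *
                  deltaV (Fin.snoc x' t : Fin (m + 1) → ℝ) (m + 1 - 1) ^ (-r (m + 1 + 1)) *
                  deltaV (Fin.snoc x' t : Fin (m + 1) → ℝ) (m + 1) ^ (-r (m + 1 + 2))))
          ≤ ∫⁻ x' in (Set.pi Set.univ fun _ : Fin m => Ioo (0 : ℝ) 1), C * ENNReal.ofReal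
              ((∏ k ∈ Icc 1 m, coord x' k ^ α k * (1 - coord x' k) ^ β k * deltaV x' k ^ (-γ k)) *
                (coord x' m ^ (-r (m + 1)) * deltaV x' (m - 1) ^ (-r (m + 1)) * deltaV x' m ^ (-r (m + 2)))) := by
            refine setLIntegral_mono' (measurableSet_openCube m) fun x' hx' => ?_
            have hx := mem_openCube_iff.1 hx'
            obtain ⟨hδ0, -, hδ1⟩ := deltaV_mem hx m le_rfl
            have hδ1' := hδ1 hmpos
            set G : ℝ := (∏ k ∈ Icc 1 m, coord x' k ^ α k * (1 - coord x' k) ^ β k * deltaV x' k ^ (-γ k)) *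
              deltaV x' m ^ (-r (m + 2)) with hG
            have hG0 : 0 ≤ G := by
              rw [hG]; exact mul_nonneg (phiProd_pos α β γ hx).le (Real.rpow_nonneg hδ0.le _)
            calc ∫⁻ t in Ioo (0 : ℝ) 1, ENNReal.ofReal
                  ((∏ k ∈ Icc 1 (m + 1), coord (Fin.snoc x' t : Fin (m + 1) → ℝ) k ^ α k *
                      (1 - coord (Fin.snoc x' t : Fin (m + 1) → ℝ) k) ^ β k *
                      deltaV (Fin.snoc x' t : Fin (m + 1) → ℝ) k ^ (-γ k)) *
                    (coord (Fin.snoc x' t : Fin (m + 1) → ℝ) (m + 1) ^ (-r (m + 1 + 1)) *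
                      deltaV (Fin.snoc x' t : Fin (m + 1) → ℝ) (m + 1 - 1) ^ (-r (m + 1 + 1)) *
                      deltaV (Fin.snoc x' t : Fin (m + 1) → ℝ) (m + 1) ^ (-r (m + 1 + 2))))
                = ∫⁻ t in Ioo (0 : ℝ) 1, ENNReal.ofReal G * ENNReal.ofReal
                    (t ^ (α (m + 1) - r (m + 2)) * (1 - t) ^ β (m + 1) *
                      (1 - t * deltaV x' m) ^ (-(γ (m + 1) + r (m + 3)))) := by
                  refine setLIntegral_congr_fun measurableSet_Ioo fun t ht => ?_
                  rw [phi_snoc α β γ r hmpos hx ht, ← hG, ENNReal.ofReal_mul hG0]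
              _ = ENNReal.ofReal G * ∫⁻ t in Ioo (0 : ℝ) 1, ENNReal.ofReal
                    (t ^ (α (m + 1) - r (m + 2)) * (1 - t) ^ β (m + 1) *
                      (1 - t * deltaV x' m) ^ (-(γ (m + 1) + r (m + 3)))) :=
                  lintegral_const_mul' _ _ ENNReal.ofReal_ne_top
              _ ≤ ENNReal.ofReal G * (C * ENNReal.ofReal ((1 - deltaV x' m) ^ (-r (m + 1)))) :=
                  mul_le_mul' le_rfl (hCb _ hδ0.le hδ1')
              _ = C * ENNReal.ofReal (G * (1 - deltaV x' m) ^ (-r (m + 1))) := by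
                  rw [ENNReal.ofReal_mul hG0]; ring
              _ = _ := by rw [hG, phi_factor α β γ r hmpos hx]
        _ = C * ∫⁻ x' in (Set.pi Set.univ fun _ : Fin m => Ioo (0 : ℝ) 1), ENNReal.ofReal
              ((∏ k ∈ Icc 1 m, coord x' k ^ α k * (1 - coord x' k) ^ β k * deltaV x' k ^ (-γ k)) *
                (coord x' m ^ (-r (m + 1)) * deltaV x' (m - 1) ^ (-r (m + 1)) * deltaV x' m ^ (-r (m + 2)))) :=
            lintegral_const_mul' _ _ hC
        _ < ∞ := ENNReal.mul_lt_top hC.lt_top ih'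

/-! ### From `𝒥(p)` to `Φ`: the integrand on the open cube -/

/-- Unfolding of the recursion `ρ_k` below `n`: `ρ_k = ρ⁺_{k+2} + c̃_k − 1 − b_k` for `k ≤ n`.
[cite: Fischler2003RhinViola, §4.1 p. 521 (définition de ρ_k)] -/
theorem rho_of_le {n : ℕ} (p : Exponents) {k : ℕ} (hk : k ≤ n) :
    rho n p k = max (rho n p (k + 2)) 0 + cTilde n p k - 1 - p.b k := by
  rw [rho, dif_neg (by omega)]

/-- `ρ_k = 0` for `k > n`. [cite: Fischler2003RhinViola, §4.1 p. 521 (définition de ρ_k)] -/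
theorem rho_of_lt {n : ℕ} (p : Exponents) {k : ℕ} (hk : n < k) : rho n p k = 0 := by
  rw [rho, dif_pos hk]

/-- **The integrand of `𝒥(p)` on the open cube, with real exponents**: for `n ≥ 2` and `x ∈ (0,1)^n`,
`integrandJ n p x = ∏_{k=1}^{n} x_k^{a_k}(1−x_k)^{b_k}δ_k^{−γ_k}` with `γ₁ = 0`, `γ_k = c̃_k` (`k ≥ 2`), i.e.
`γ_k = c_k` for `2 ≤ k < n` and `γ_n = c_n + 1`. [cite: Fischler2002Polyzetas, §3 p. 4 (definition of 𝒥(p))] -/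
theorem integrandJ_eq_rpow_prod {n : ℕ} (hn : 2 ≤ n) (p : Exponents) {x : Fin n → ℝ}
    (hx : ∀ i, 0 < x i ∧ x i < 1) :
    integrandJ n p x = ∏ k ∈ Icc 1 n, coord x k ^ (p.a k : ℝ) * (1 - coord x k) ^ (p.b k : ℝ) *
      deltaV x k ^ (-(if k = 1 then (0 : ℝ) else (cTilde n p k : ℝ))) := by
  obtain ⟨m, rfl⟩ : ∃ m, n = m + 1 := ⟨n - 1, by omega⟩
  unfold integrandJ
  simp_rw [← Real.rpow_intCast]
  conv_rhs => rw [Finset.prod_mul_distrib]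
  -- the `δ`-part
  have hδpos : ∀ k, k ≤ m + 1 → 0 < deltaV x k := fun k hk => (deltaV_mem hx k hk).1
  have hD : ∏ k ∈ Icc 1 (m + 1), deltaV x k ^ (-(if k = 1 then (0 : ℝ) else (cTilde (m + 1) p k : ℝ))) =
      (∏ k ∈ Icc 2 (m + 1), deltaV x k ^ ((p.c k : ℤ) : ℝ))⁻¹ * (deltaV x (m + 1))⁻¹ := by
    rw [prod_Icc_one_eq_mul (by omega), if_pos rfl, neg_zero, Real.rpow_zero, one_mul,
      Finset.prod_Icc_succ_top (by omega : 2 ≤ m + 1), Finset.prod_Icc_succ_top (by omega : 2 ≤ m + 1),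
      mul_inv, ← Finset.prod_inv_distrib]
    have h1 : ∏ k ∈ Icc 2 m, deltaV x k ^ (-(if k = 1 then (0 : ℝ) else (cTilde (m + 1) p k : ℝ))) =
        ∏ k ∈ Icc 2 m, (deltaV x k ^ ((p.c k : ℤ) : ℝ))⁻¹ := by
      refine Finset.prod_congr rfl fun k hk => ?_
      have hk' := Finset.mem_Icc.1 hk
      rw [if_neg (by omega), cTilde, if_neg (by omega), if_neg (by omega),
        Real.rpow_neg (hδpos k (by omega)).le]
    have h2 : deltaV x (m + 1) ^ (-(if m + 1 = 1 then (0 : ℝ) else (cTilde (m + 1) p (m + 1) : ℝ))) =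
        (deltaV x (m + 1) ^ ((p.c (m + 1) : ℤ) : ℝ))⁻¹ * (deltaV x (m + 1))⁻¹ := by
      rw [if_neg (by omega), cTilde, if_neg (by omega), if_pos rfl]
      push_cast
      rw [show -((p.c (m + 1) : ℝ) + 1) = -(p.c (m + 1) : ℝ) + (-1) by ring,
        Real.rpow_add (hδpos (m + 1) le_rfl), Real.rpow_neg (hδpos (m + 1) le_rfl).le, Real.rpow_neg_one]
    rw [h1, h2]
    ring
  rw [hD]
  ring

/-- The extra factors of `Φ_n` are `≥ 1` on the open cube (`n ≥ 1`, `r ≥ 0`), so the product part is at most `Φ_n`.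
[cite: Fischler2003RhinViola, §4.1 Proposition 13 (the peeled integrand)] -/
theorem prod_le_phi (α β γ r : ℕ → ℝ) (hr : ∀ k, 0 ≤ r k) {n : ℕ} (hn : 1 ≤ n) {x : Fin n → ℝ}
    (hx : ∀ i, 0 < x i ∧ x i < 1) :
    (∏ k ∈ Icc 1 n, coord x k ^ α k * (1 - coord x k) ^ β k * deltaV x k ^ (-γ k)) ≤
      (∏ k ∈ Icc 1 n, coord x k ^ α k * (1 - coord x k) ^ β k * deltaV x k ^ (-γ k)) *
        (coord x n ^ (-r (n + 1)) * deltaV x (n - 1) ^ (-r (n + 1)) * deltaV x n ^ (-r (n + 2))) := by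
  refine le_mul_of_one_le_right (phiProd_pos α β γ hx).le ?_
  obtain ⟨h0, h1⟩ := coord_mem hx hn le_rfl
  obtain ⟨hd0, hd1, -⟩ := deltaV_mem hx n le_rfl
  obtain ⟨he0, he1, -⟩ := deltaV_mem hx (n - 1) (by omega)
  have hA : 1 ≤ coord x n ^ (-r (n + 1)) :=
    Real.one_le_rpow_of_pos_of_le_one_of_nonpos h0 h1.le (by linarith [hr (n + 1)])
  have hB : 1 ≤ deltaV x (n - 1) ^ (-r (n + 1)) :=
    Real.one_le_rpow_of_pos_of_le_one_of_nonpos he0 he1 (by linarith [hr (n + 1)])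
  have hC : 1 ≤ deltaV x n ^ (-r (n + 2)) :=
    Real.one_le_rpow_of_pos_of_le_one_of_nonpos hd0 hd1 (by linarith [hr (n + 2)])
  calc (1 : ℝ) = 1 * 1 * 1 := by ring
    _ ≤ _ := mul_le_mul (mul_le_mul hA hB zero_le_one (by linarith)) hC zero_le_one (by positivity)

end JnFinite

end Literature.NumberTheory.Irrationality.Fischler2002

end
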